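import Summits.AtomisticToContinuum.Crystallization.Theorems.ExcessDecayLiouvilleHcpLiouvilleSymmetricShift

/-!
# `ExcessDecayLiouville.HcpLiouville` (stmt-AtomisticToContinuum-9332): the relaxed-shift input reduces to NORMALISED cells

Line `Sketch` v5.3, input `stub_relaxedShift` (every admissible cell `A`, `‖A − 0.97·R‖ ≤ 1/40` for some linear isometry
`R`, has a zero of its optical force within `1/40` of the geometric shift `A m`, `m = w₀ + √(2/3)e₃`).  By isometry
COVARIANCE of the optical force (`F(R x) = R (F x)`, `ljForce_map_linearIsometryEquiv`) the statement for `A` follows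
from the statement for the normalised cell `B = R⁻¹ ∘ A`, which satisfies `‖B − 0.97·1‖ ≤ 1/40`: a zero `e` for `B`
gives the zero `R e` for `A`.  So the certificate only has to cover the 9-dimensional ball `‖B − 0.97·1‖ ≤ 1/40`
(no isometry quantifier).  Registered sub-goal `relaxedShift_of_normalised`.  All `[folklore]`; a `--supports` helper
for item stmt-AtomisticToContinuum-9332, nothing here closes an item.
-/

noncomputable section

namespace Summit.AtomisticToContinuum.Crystallization.Theorems.ExcessDecayLiouville

open scoped BigOperators Topology Classical InnerProductSpace
open Literature.MathematicalPhysics.StatisticalMechanics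
open Summit.AtomisticToContinuum.Crystallization.Theses.ExcessDecayLiouville
open Summit.AtomisticToContinuum.Crystallization.Theorems.PhononStabilityNegative

local notation "E3" => EuclideanSpace ℝ (Fin 3)

/-- **The relaxed-shift input reduces to normalised cells** (registered sub-goal of crux stmt-AtomisticToContinuum-9332,
line `Sketch` v5.3): if every `B` with `‖B − 0.97·1‖ ≤ 1/40` has a zero of its optical force within `1/40` of `B m`, then
so does every admissible cell `A` (take `B = R⁻¹ ∘ A` for the isometry `R` of `Adm₀ A` and transport the zero by `R`).
[folklore] -/
theorem relaxedShift_of_normalised :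
    (∀ (B : E3 →L[ℝ] E3), ‖B - (97 / 100 : ℝ) • ContinuousLinearMap.id ℝ E3‖ ≤ 1 / 40 →
      ∃ e : E3, ‖e - B (barlowOffset 1 + layerNormal (Real.sqrt (2 / 3)))‖ ≤ 1 / 40 ∧
        HasSum (fun z : Λ₀ => (deriv lennardJones ‖e + B z‖ / ‖e + B z‖) • (e + B z)) 0) →
    ∀ (A : E3 →L[ℝ] E3), Adm₀ A →
      ∃ e : E3, ‖e - A (barlowOffset 1 + layerNormal (Real.sqrt (2 / 3)))‖ ≤ 1 / 40 ∧
        HasSum (fun z : Λ₀ => (deriv lennardJones ‖e + A z‖ / ‖e + A z‖) • (e + A z)) 0 := by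
  intro hN A hA
  obtain ⟨R, hR⟩ := hA
  -- the normalised cell `B = R⁻¹ ∘ A`
  set B : E3 →L[ℝ] E3 := (R.symm.toContinuousLinearEquiv : E3 →L[ℝ] E3).comp A with hB
  have hBapply : ∀ x : E3, B x = R.symm (A x) := fun x => rfl
  have hRB : ∀ x : E3, R (B x) = A x := fun x => by rw [hBapply, LinearIsometryEquiv.apply_symm_apply]
  have hBnorm : ‖B - (97 / 100 : ℝ) • ContinuousLinearMap.id ℝ E3‖ ≤ 1 / 40 := by
    refine ContinuousLinearMap.opNorm_le_bound _ (by norm_num) fun x => ?_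
    have h1 : (B - (97 / 100 : ℝ) • ContinuousLinearMap.id ℝ E3) x =
        R.symm ((A - (97 / 100 : ℝ) • (R.toContinuousLinearEquiv : E3 →L[ℝ] E3)) x) := by
      simp only [FunLike.coe_sub, FunLike.coe_smul, Pi.sub_apply, Pi.smul_apply, ContinuousLinearMap.id_apply,
        hBapply, map_sub, LinearIsometryEquiv.map_smul, ContinuousLinearEquiv.coe_coe,
        LinearIsometryEquiv.coe_toContinuousLinearEquiv, LinearIsometryEquiv.symm_apply_apply]
    rw [h1, LinearIsometryEquiv.norm_map]
    exact (A - (97 / 100 : ℝ) • (R.toContinuousLinearEquiv : E3 →L[ℝ] E3)).le_of_opNorm_le hR x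
  obtain ⟨e, he, hsum⟩ := hN B hBnorm
  refine ⟨R e, ?_, ?_⟩
  · have h2 : R e - A (barlowOffset 1 + layerNormal (Real.sqrt (2 / 3))) =
        R (e - B (barlowOffset 1 + layerNormal (Real.sqrt (2 / 3)))) := by
      rw [map_sub, hRB]
    rw [h2, LinearIsometryEquiv.norm_map]
    exact he
  · have h3 : (fun z : Λ₀ => (deriv lennardJones ‖R e + A z‖ / ‖R e + A z‖) • (R e + A z)) =
        fun z : Λ₀ => (R.toContinuousLinearEquiv : E3 →L[ℝ] E3)
          ((deriv lennardJones ‖e + B z‖ / ‖e + B z‖) • (e + B z)) := by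
      funext z
      have h4 : R e + A z = R (e + B z) := by rw [map_add, hRB]
      rw [h4, ljForce_map_linearIsometryEquiv]
      rfl
    rw [h3]
    simpa using (hsum.mapL (R.toContinuousLinearEquiv : E3 →L[ℝ] E3))

end Summit.AtomisticToContinuum.Crystallization.Theorems.ExcessDecayLiouville

end
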